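import Literature.AlgebraicGeometry.HodgeTheory.PeriodIntegralHolomorphic
import Literature.AlgebraicGeometry.HodgeTheory.WedgePairingL2Bound
import Literature.Geometry.Kaehler.PullbackFamilyL2Lipschitz
import HarnessLib

/-!
# Differentiability of the Hodge test functionals along `L²`-continuous sections
# (Voisin I, proof of Thm. 10.9, with continuous instead of `C^∞` sections)

Topic: Hodge theory in families (Griffiths 1968; Voisin (2002), §10.1.2 Thm. 10.9). Theorems only,
no definition, no named fact. Written by the prover seat `hodge-nonav-prover-Bx` (g17, cell
`hodge-nonav`) as brick **K5c** of the programme «GRIFFITHS-HOLOMORPHY» (memo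
`PROGRAMME-GRIFFITHS-HOLOMORPHY-Bx-g17.md`): the analytic core of the clause `hdiff` of
`Literature.Analysis.Complex.exists_analyticOnNhd_frame_of_ker_of_differentiableAt` for the Hodge
bundles.

Setting of the type heart `differentiableAt_complex_cintegral_wedge_pullback_family`
(`PeriodIntegralHolomorphic`): a compact oriented `M` (smooth metric, `vol_o` smooth), a family
`Ψ : P → M → T` jointly smooth near `{t} × M` over a complex parameter space `P` with `π ∘ Ψ_p = p`,
the fibre `Ψ_t = ι ∘ φ` (`ι` holomorphic immersion, `φ : M → X`), a smooth `(k+1)`-form `Ξ` on `T`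
with `ι^*Ξ = 0` and `dΞ ∈ F^{p₀}` along the fibre, and a closed `β ∈ F^{n-p₀+1}A^l(X)`. Voisin proves
that `G(p) = ∫_M φ^*β ∧ Ψ_p^*Ξ` is `ℂ`-differentiable at `t`. HERE: if `a : P → A^l(M; ℂ)` is any
map into the `L²` pre-Hilbert space of smooth `l`-forms which is CONTINUOUS at `t` (for `‖·‖_{L²}`)
with `a(t) = φ^*β`, then `ψ(p) = ∫_M a(p) ∧ Ψ_p^*Ξ` is `ℂ`-differentiable at `t` as well
(`differentiableAt_complex_cintegral_wedge_pullback_family_of_tendsto`): indeed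
`|ψ(p) - G(p)| = |∫_M (a(p) - a(t)) ∧ (Ψ_p^*Ξ - Ψ_t^*Ξ)| ≤ 2 ‖a(p) - a(t)‖ · ‖Ψ_p^*Ξ - Ψ_t^*Ξ‖`
(`Ψ_t^*Ξ = φ^*ι^*Ξ = 0`; the `L²` bound `norm_cintegral_wedge_le`), which is `o(‖p - t‖)` by the
`L²`-Lipschitz bound `exists_forall_norm_mk_pullback_sub_le`, so `ψ` has the same derivative as `G`
at `t`. In the programme, `a(p)` is the transported harmonic representative of a class
`σ(p) ∈ F^pH^k(X_p)` depending continuously on `p` (brick K1), and `ψ(p) = Q(σ(p), [β_j])`.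

## References

* C. Voisin, *Hodge Theory and Complex Algebraic Geometry I*, CUP (2002), §10.1.2, proof of Thm. 10.9.
  [VoisinHodgeI2002]
* P. Griffiths, Periods of integrals on algebraic manifolds II, Amer. J. Math. 90 (1968), Thm. 1.1.
  [Griffiths1968]
-/

noncomputable section

open scoped Manifold ContDiff Topology
open Bundle Set Function Filter Module Complex Asymptotics
open Literature.Geometry.Kaehler Literature.NumberTheory.Transcendental
open Literature.AlgebraicGeometry.Motives Literature.Analysis.Complex

namespace Literature.AlgebraicGeometry.HodgeTheory

-- The identification `TangentSpace I x = E` is an abuse of definitional equality; as in the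
-- tree's form files we let `isDefEq` unfold it.
set_option backward.isDefEq.respectTransparency false

variable {EM : Type*} [NormedAddCommGroup EM] [NormedSpace ℂ EM] [FiniteDimensional ℂ EM]
  [MeasurableSpace EM] [BorelSpace EM] {N : ℕ} [Fact (finrank ℝ EM = N)]
  {M : Type*} [TopologicalSpace M] [ChartedSpace EM M] [IsManifold 𝓘(ℝ, EM) ∞ M]
  [T2Space M] [CompactSpace M]
  [RiemannianBundle (fun x : M ↦ TangentSpace 𝓘(ℝ, EM) x)]
  [IsContMDiffRiemannianBundle 𝓘(ℝ, EM) ∞ EM (fun x : M ↦ TangentSpace 𝓘(ℝ, EM) x)]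
  (o : (x : M) → Orientation ℝ (TangentSpace 𝓘(ℝ, EM) x) (Fin N))
  {ET : Type*} [NormedAddCommGroup ET] [NormedSpace ℂ ET]
  {T : Type*} [TopologicalSpace T] [ChartedSpace ET T] [IsManifold 𝓘(ℝ, ET) ∞ T]
  {EX : Type*} [NormedAddCommGroup EX] [NormedSpace ℂ EX] [FiniteDimensional ℂ EX]
  {X : Type*} [TopologicalSpace X] [ChartedSpace EX X] [IsManifold 𝓘(ℝ, EX) ∞ X]
  {P : Type*} [NormedAddCommGroup P] [NormedSpace ℂ P] [FiniteDimensional ℂ P]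

omit [RiemannianBundle fun x : M ↦ TangentSpace 𝓘(ℝ, EM) x]
  [IsContMDiffRiemannianBundle 𝓘(ℝ, EM) ∞ EM fun x : M ↦ TangentSpace 𝓘(ℝ, EM) x] in
/-- The complex integral of smooth top forms is subtractive. [cite: WarnerGTM94, 4.8] -/
theorem cintegral_sub' (ho : IsContinuousOrientation o) {α γ : MForm 𝓘(ℝ, EM) M ℂ N}
    (hα : IsSmoothForm α) (hγ : IsSmoothForm γ) :
    cintegral o (α - γ) = cintegral o α - cintegral o γ := by
  have h := HodgeRiemannDegreeOne.cintegral_add' o ho (hα.sub hγ) hγ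
  rw [sub_add_cancel] at h
  rw [h, add_sub_cancel_right]

/-- **Differentiability of the Hodge test functionals along `L²`-continuous sections** (Voisin
(2002), proof of Thm. 10.9, the type mechanism `differentiableAt_complex_cintegral_wedge_pullback_family`
upgraded from the fixed section `φ^*β` to any `L²`-continuous `a` with `a(t) = φ^*β`; statement and
proof in the module docstring). All the data of the type heart, plus a smooth metric on `M` with
`vol_o` smooth and `a : P → A^l(M; ℂ)` continuous at `t` in `L²` with `a t = φ^*β`. Conclusion:
`p ↦ ∫_M a(p) ∧ Ψ_p^*Ξ` is complex differentiable at `t`. [cite: VoisinHodgeI2002, §10.1.2 (proof of Thm. 10.9)] -/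
theorem differentiableAt_complex_cintegral_wedge_pullback_family_of_tendsto
    (hov : IsSmoothForm (riemannianVolumeForm o))
    {Ψ : P → M → T} {U : Set P} (hU : IsOpen U) {t : P} (ht : t ∈ U)
    (hΨ : ∀ p ∈ U, ∀ x, ContMDiffAt (𝓘(ℝ, P).prod 𝓘(ℝ, EM)) 𝓘(ℝ, ET) ∞ (uncurry Ψ) (p, x))
    {proj : T → P} (hπΨ : ∀ p ∈ U, ∀ x, proj (Ψ p x) = p)
    (hπd : ∀ x, MDifferentiableAt 𝓘(ℝ, ET) 𝓘(ℝ, P) proj (Ψ t x))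
    (hπℂ : ∀ x (v : ET), mfderiv 𝓘(ℝ, ET) 𝓘(ℝ, P) proj (Ψ t x) (I • v) =
      I • (show P from mfderiv 𝓘(ℝ, ET) 𝓘(ℝ, P) proj (Ψ t x) v))
    {ι : X → T} {φ : M → X} (hιφ : ι ∘ φ = Ψ t)
    (hι : ContMDiff 𝓘(ℝ, EX) 𝓘(ℝ, ET) ∞ ι) (hφ : ContMDiff 𝓘(ℝ, EM) 𝓘(ℝ, EX) ∞ φ)
    (hιℂ : ∀ y (v : EX), mfderiv 𝓘(ℝ, EX) 𝓘(ℝ, ET) ι y (I • v) =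
      I • (show ET from mfderiv 𝓘(ℝ, EX) 𝓘(ℝ, ET) ι y v))
    (hvert : ∀ x (w : ET), mfderiv 𝓘(ℝ, ET) 𝓘(ℝ, P) proj (Ψ t x) w = 0 →
      ∃ w' : EX, mfderiv 𝓘(ℝ, EX) 𝓘(ℝ, ET) ι (φ x) w' = w)
    {k l : ℕ} (hkl : l + (k + 1) = N) (hXN : finrank ℝ EX = N) {p₀ : ℕ}
    {Ξ : MForm 𝓘(ℝ, ET) T ℂ (k + 1)} (hΞ : IsSmoothForm Ξ)
    (hΞι : Ξ.pullback 𝓘(ℝ, EX) ι = 0)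
    (hdΞ : ∀ x r s, r < p₀ →
      typeProjAt r s (show ET [⋀^Fin (k + 1 + 1)]→L[ℝ] ℂ from mextDeriv Ξ (Ψ t x)) = 0)
    {β : MForm 𝓘(ℝ, EX) X ℂ l} (hβ : IsSmoothForm β) (hβc : IsClosedForm β)
    (hβF : ∀ y a b, a + p₀ ≤ finrank ℂ EX →
      typeProjAt a b (show EX [⋀^Fin l]→L[ℝ] ℂ from β y) = 0) :
    haveI : Fact (IsSmoothForm (riemannianVolumeForm o)) := ⟨hov⟩
    ∀ (a : P → CL2SmoothForms o l), Tendsto a (𝓝 t) (𝓝 (a t)) →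
      CL2SmoothForms.toForm o (a t) = β.pullback 𝓘(ℝ, EM) φ →
      DifferentiableAt ℂ (fun p ↦ cintegral o
        (((CL2SmoothForms.toForm o (a p)).wedge (Ξ.pullback 𝓘(ℝ, EM) (Ψ p))).castDeg hkl)) t := by
  haveI : Fact (IsSmoothForm (riemannianVolumeForm o)) := ⟨hov⟩
  intro a ha hat
  haveI : WedgeFacts 𝓘(ℝ, EM) M ℂ := wedgeFacts_discharged _ _ ℂ
  haveI : IsContinuousRiemannianBundle EM (fun x : M ↦ TangentSpace 𝓘(ℝ, EM) x) :=
    isContinuousRiemannianBundle_of_isContMDiffRiemannianBundle 𝓘(ℝ, EM) ∞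
  have ho : IsContinuousOrientation o :=
    isContinuousOrientation_of_isSmoothForm_riemannianVolumeForm_holds o hov
  -- notation
  set Z : P → MForm 𝓘(ℝ, EM) M ℂ (k + 1) := fun p ↦ Ξ.pullback 𝓘(ℝ, EM) (Ψ p) with hZ
  set γ : MForm 𝓘(ℝ, EM) M ℂ l := β.pullback 𝓘(ℝ, EM) φ with hγ
  set G : P → ℂ := fun p ↦ cintegral o ((γ.wedge (Z p)).castDeg hkl) with hG
  set ψ : P → ℂ := fun p ↦
    cintegral o (((CL2SmoothForms.toForm o (a p)).wedge (Z p)).castDeg hkl) with hψ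
  change DifferentiableAt ℂ ψ t
  -- Voisin's computation: `G` is `ℂ`-differentiable at `t`
  have hGd : DifferentiableAt ℂ G t :=
    differentiableAt_complex_cintegral_wedge_pullback_family (o := o) ho hU ht hΨ hπΨ hπd hπℂ hιφ hι hφ
      hιℂ hvert hkl hXN hΞ hΞι hdΞ hβ hβc hβF
  -- smoothness facts
  have hγs : IsSmoothForm γ := isSmoothForm_pullback hφ hβ
  have hΨp : ∀ p ∈ U, ContMDiff 𝓘(ℝ, EM) 𝓘(ℝ, ET) ∞ (Ψ p) := by
    intro p hp x
    exact ((hΨ p hp x).comp x (contMDiffAt_const.prodMk contMDiffAt_id)).of_le le_rfl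
  have hZs : ∀ p ∈ U, IsSmoothForm (Z p) := fun p hp ↦ isSmoothForm_pullback (hΨp p hp) hΞ
  -- `Ψ_t^*Ξ = φ^*(ι^*Ξ) = 0`
  have hZt : Z t = 0 := by
    have hιd : MDifferentiable 𝓘(ℝ, EX) 𝓘(ℝ, ET) ι := hι.mdifferentiable (by simp)
    have hφd : MDifferentiable 𝓘(ℝ, EM) 𝓘(ℝ, EX) φ := hφ.mdifferentiable (by simp)
    change Ξ.pullback 𝓘(ℝ, EM) (Ψ t) = 0
    rw [← hιφ, MForm.pullback_comp hιd hφd, hΞι, MForm.pullback_zero]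
  -- the `L²` Lipschitz bound for `Z`
  obtain ⟨C, hC0, hC⟩ := exists_forall_norm_mk_pullback_sub_le o hov (IT := 𝓘(ℝ, ET)) hU ht hΨ
    (m := l) (by omega) hΞ
  -- `ψ - G` is `o(p - t)`
  have hsmall : (fun p ↦ ψ p - G p) =o[𝓝 t] fun p ↦ p - t := by
    refine Asymptotics.IsLittleO.of_bound fun ε hε ↦ ?_
    -- `‖a p - a t‖` is eventually `≤ ε / (2C + 1)`
    have hεC : 0 < ε / (2 * C + 1) := div_pos hε (by linarith)
    have ha' : ∀ᶠ p in 𝓝 t, ‖a p - a t‖ ≤ ε / (2 * C + 1) := by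
      have := (Metric.tendsto_nhds.1 ha) _ hεC
      exact this.mono fun p hp ↦ by rw [dist_eq_norm] at hp; exact hp.le
    filter_upwards [ha', hC, hU.mem_nhds ht] with p hap hCp hpU
    -- the integrand of `ψ p - G p`
    have hdiff_s : IsSmoothForm (CL2SmoothForms.toForm o (a p) - γ) :=
      (CL2SmoothForms.isSmoothForm_toForm o (a p)).sub hγs
    have hsub : ψ p - G p =
        cintegral o (((CL2SmoothForms.toForm o (a p) - γ).wedge (Z p)).castDeg hkl) := by
      rw [hψ, hG, MForm.sub_wedge, MForm.castDeg_sub]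
      exact (cintegral_sub' o ho
        (isSmoothForm_castDeg hkl (isSmoothForm_wedge (CL2SmoothForms.isSmoothForm_toForm o (a p)) (hZs p hpU)))
        (isSmoothForm_castDeg hkl (isSmoothForm_wedge hγs (hZs p hpU)))).symm
    -- `Z p = Z p - Z t`
    have hZp : Z p = Z p - Z t := by rw [hZt, sub_zero]
    have hZps : IsSmoothForm (Z p - Z t) := by rw [← hZp]; exact hZs p hpU
    have hbound := norm_cintegral_wedge_le o hov hkl hdiff_s hZps
    have hCp' := hCp hZps
    -- `mk (toForm (a p) - γ) = a p - a t`
    have hmk : CL2SmoothForms.mk o (CL2SmoothForms.toForm o (a p) - γ) hdiff_s = a p - a t := by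
      have : ∀ (δ : MForm 𝓘(ℝ, EM) M ℂ l) (hδ : IsSmoothForm (CL2SmoothForms.toForm o (a p) - δ)),
          δ = CL2SmoothForms.toForm o (a t) →
          CL2SmoothForms.mk o (CL2SmoothForms.toForm o (a p) - δ) hδ = a p - a t := by
        rintro δ hδ rfl
        rfl
      exact this γ hdiff_s hat.symm
    rw [hsub]
    calc ‖cintegral o (((CL2SmoothForms.toForm o (a p) - γ).wedge (Z p)).castDeg hkl)‖
        = ‖cintegral o (((CL2SmoothForms.toForm o (a p) - γ).wedge (Z p - Z t)).castDeg hkl)‖ := by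
          rw [← hZp]
      _ ≤ 2 * ‖CL2SmoothForms.mk o _ hdiff_s‖ * ‖CL2SmoothForms.mk o _ hZps‖ := hbound
      _ ≤ 2 * (ε / (2 * C + 1)) * (C * ‖p - t‖) := by
          rw [hmk]
          exact mul_le_mul (mul_le_mul_of_nonneg_left hap (by norm_num)) hCp' (norm_nonneg _)
            (by positivity)
      _ ≤ ε * ‖p - t‖ := by
          have h1 : 2 * (ε / (2 * C + 1)) * C ≤ ε := by
            rw [mul_comm 2, mul_assoc, div_mul_eq_mul_div, div_le_iff₀ (by linarith)]
            nlinarith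
          calc 2 * (ε / (2 * C + 1)) * (C * ‖p - t‖) = (2 * (ε / (2 * C + 1)) * C) * ‖p - t‖ := by ring
            _ ≤ ε * ‖p - t‖ := mul_le_mul_of_nonneg_right h1 (norm_nonneg _)
  -- hence `ψ` has the same derivative as `G` at `t`
  have hGt : HasFDerivAt G (fderiv ℂ G t) t := hGd.hasFDerivAt
  have hψG : HasFDerivAt (fun p ↦ ψ p - G p) (0 : P →L[ℂ] ℂ) t := by
    refine HasFDerivAt.of_isLittleO ?_
    have h0 : ψ t - G t = 0 := by
      simp only [hψ, hG]
      rw [hZt, MForm.wedge_zero, MForm.wedge_zero, sub_self]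
    simpa [h0] using hsmall
  have hψd : HasFDerivAt ψ (fderiv ℂ G t) t := by
    have h := hψG.add hGt
    rw [zero_add] at h
    exact h.congr_of_eventuallyEq (Eventually.of_forall fun p ↦ by simp)
  exact hψd.differentiableAt

end Literature.AlgebraicGeometry.HodgeTheory

end
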